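import Mathlib.LinearAlgebra.FreeModule.ModN
import Mathlib.GroupTheory.FiniteAbelian.Basic
import Literature.NumberTheory.EllipticCurves.MordellWeilTheoremProofs
import Literature.NumberTheory.EllipticCurves.KramerDescent
import HarnessLib

/-!
# `#(E(K)/nE(K)) = n ^ rank E(K) · #E(K)[n]` (Silverman AEC VIII.§1 / X.1, the descent count)

The exact count behind every `2`-descent (and `n`-descent) rank computation — Silverman, *The
Arithmetic of Elliptic Curves*, 2nd ed., proof of Thm. X.1.1 / Example X.1.5 and Ex. 10.8:
"`E(K)/2E(K) ≅ (ℤ/2ℤ)^{r} × E(K)[2]`" up to isomorphism of finite groups, i.e.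
`dim_{𝔽₂} E(K)/2E(K) = rank E(K) + dim_{𝔽₂} E(K)[2]`; K. Matsuno, Math. Res. Lett. 16 (2009),
p. 460: "`rank_ℤ A_d(ℚ) ≤ dim_{𝔽₂} Sel₂(A_d/ℚ) − dim_{𝔽₂} A_d(ℚ)[2]`" — as an EQUALITY of
cardinalities, for any finitely generated abelian group and any `n ≥ 1`:

* `natCard_quotient_nsmulRange_eq` — `#(M/nM) = n ^ rank_ℤ M · #M[n]` for `M` finitely generated
  (`M/nM ↠ L/nL` for the free quotient `L = M/M_tors`, `#(L/nL) = n ^ rank` by Mathlib's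
  `ModN.natCard_eq`, kernel `≅ T/(T ∩ nM) = T/nT` for `T = M_tors`, and `#(T/nT) = #T[n] = #M[n]`
  since kernel and cokernel of `n` on the finite group `T` have the same order, `card_range_mul_card_ker`
  of `KramerDescent.lean`);
* `natCard_quotient_nsmulRange_point_eq` — the same for `E(K)`, `E` elliptic over a number field
  (Mordell–Weil, tree theorem `WeierstrassCurve.module_finite_point_holds`), with
  `rank_ℤ = WeierstrassCurve.mordellWeilRank`;
* `finite_torsionBy_of_moduleFinite` — `M[n]` is finite;
* `four_le_natCard_torsionBy_two_of_splitTwoTorsion` — with rational `2`-torsion `e₁, e₂, e₃`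
  (`SplitTwoTorsion`, `TwoDescent.lean`), `#E(F)[2] ≥ 4`.

The tree so far had the two inequalities separately (`finite_modN_and_natCard_le` in
`Literature/Barriers/BirchSwinnertonDyer/DescentDefectUnboundedMatsunoTwoProofs.lean`: `≤`;
`pow_finrank_add_two_le_natCard_range` in `TwoDescentRankBounds.lean`: `2^{rank+2} ≤ #ψ(E)` for a
separating `ψ`). Everything here is proved; the quotient is written
`M ⧸ (nsmulAddMonoidHom n).range`, the form produced by
`WeierstrassCurve.Affine.Point.ker_twoDescentMap`.

## References

* J. H. Silverman, *The Arithmetic of Elliptic Curves*, 2nd ed., GTM 106 (2009), VIII.§1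
  (weak Mordell–Weil), Thm. VIII.6.7, Prop. X.1.4, Example X.1.5. [SilvermanAEC2009]
* K. Matsuno, Math. Res. Lett. 16 (2009), 449–461, p. 460 (the count in the proof of Cor. 6.2).
  [Matsuno2009]
-/

noncomputable section

open scoped Classical

open WeierstrassCurve WeierstrassCurve.Affine

namespace Literature.NumberTheory.EllipticCurves

/-! ### Algebra: `#(M/nM) = n ^ rank_ℤ M · #M[n]` for a finitely generated abelian group -/

/-- **`#(M/nM) = n ^ rank_ℤ M · #M[n]`** for a finitely generated abelian group `M` and `n ≥ 1`:
`M/nM ↠ L/nL` for the free quotient `L = M/M_tors` of rank `rank_ℤ M` (`#(L/nL) = n ^ rank`,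
Mathlib `ModN.natCard_eq`), with kernel the image of `T = M_tors`, isomorphic to `T/(T ∩ nM) =
T/nT`, and `#(T/nT) = #T[n] = #M[n]` for the finite group `T` (kernel and cokernel of `n` on a
finite abelian group have the same order). This is the count "`dim_{𝔽₂} E(ℚ)/2E(ℚ) = rank E(ℚ) +
dim_{𝔽₂} E(ℚ)[2]`" behind "`rank_ℤ A_d(ℚ) ≤ dim_{𝔽₂} Sel₂(A_d/ℚ) − dim_{𝔽₂} A_d(ℚ)[2]`" on
p. 460 of Matsuno (2009). [folklore] -/
theorem natCard_quotient_nsmulRange_eq (M : Type*) [AddCommGroup M] [Module.Finite ℤ M]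
    (n : ℕ) [NeZero n] :
    Nat.card (M ⧸ (nsmulAddMonoidHom n : M →+ M).range) =
      n ^ Module.finrank ℤ M * Nat.card (AddSubgroup.torsionBy M (n : ℤ)) := by
  haveI : IsNoetherian ℤ M := isNoetherian_of_isNoetherianRing_of_finite ℤ M
  set T := AddCommGroup.torsion M with hT
  haveI hTfin : Finite T := by
    rw [hT, ← Submodule.torsion_int]
    exact Module.finite_of_fg_torsion (Submodule.torsion ℤ M) (Submodule.torsion_isTorsion)
  -- the free quotient `L = M / T`, of rank `rank M`
  let π : M →ₗ[ℤ] M ⧸ T := (QuotientAddGroup.mk' T).toIntLinearMap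
  have hπ : Function.Surjective π := QuotientAddGroup.mk'_surjective T
  haveI : Module.Finite ℤ (M ⧸ T) := Module.Finite.of_surjective π hπ
  haveI : Module.Free ℤ (M ⧸ T) := Module.free_of_finite_type_torsion_free'
  have hrank : Module.finrank ℤ (M ⧸ T) = Module.finrank ℤ M := by
    have hker : LinearMap.ker π ≤ Submodule.torsion ℤ M := by
      intro x hx
      have hx' : x ∈ T := (QuotientAddGroup.eq_zero_iff x).mp (LinearMap.mem_ker.mp hx)
      rwa [hT, ← Submodule.torsion_int] at hx'
    rw [← (π.quotKerEquivOfSurjective hπ).finrank_eq]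
    exact finrank_quotient_eq_of_le_torsion hker
  -- `Q = M/nM ↠ L/nL`
  set nM := (nsmulAddMonoidHom n : M →+ M).range with hnM
  let φ : M →+ ModN (M ⧸ T) n := (ModN.mkQ n).comp (QuotientAddGroup.mk' T)
  have hφsurj : Function.Surjective φ :=
    (Submodule.mkQ_surjective _).comp (QuotientAddGroup.mk'_surjective _)
  have hkill : ∀ x : ModN (M ⧸ T) n, n • x = 0 := fun x => by
    rw [← Nat.cast_smul_eq_nsmul (ZMod n), ZMod.natCast_self, zero_smul]
  have hle : nM ≤ φ.ker := by
    rintro _ ⟨m, rfl⟩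
    rw [AddMonoidHom.mem_ker, nsmulAddMonoidHom_apply, map_nsmul, hkill]
  let φbar : M ⧸ nM →+ ModN (M ⧸ T) n := QuotientAddGroup.lift nM φ hle
  have hφbar_surj : Function.Surjective φbar := by
    intro y
    obtain ⟨m, rfl⟩ := hφsurj y
    exact ⟨QuotientAddGroup.mk m, rfl⟩
  -- `ψ : T → Q`, and `ker φbar = range ψ`
  let ψ : T →+ M ⧸ nM := (QuotientAddGroup.mk' nM).comp T.subtype
  have hmkT : ∀ t : T, QuotientAddGroup.mk' T (t : M) = 0 := fun t => by
    rw [QuotientAddGroup.mk'_apply, QuotientAddGroup.eq_zero_iff]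
    exact t.2
  have hkerφ : φbar.ker = ψ.range := by
    apply le_antisymm
    · intro q hq
      induction q using QuotientAddGroup.induction_on with
      | H m =>
        rw [AddMonoidHom.mem_ker] at hq
        change φ m = 0 at hq
        have hq' : (QuotientAddGroup.mk' T m : M ⧸ T) ∈
            LinearMap.range (LinearMap.lsmul ℤ (M ⧸ T) n) :=
          (Submodule.Quotient.mk_eq_zero _).mp hq
        obtain ⟨ℓ, hℓ⟩ := hq'
        obtain ⟨m', rfl⟩ := QuotientAddGroup.mk'_surjective T ℓ
        rw [LinearMap.lsmul_apply, ← map_zsmul, QuotientAddGroup.mk'_apply,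
          QuotientAddGroup.mk'_apply, QuotientAddGroup.eq_iff_sub_mem] at hℓ
        have e : (QuotientAddGroup.mk m : M ⧸ nM) =
            ψ ⟨-((n : ℤ) • m' - m), T.neg_mem hℓ⟩ + QuotientAddGroup.mk ((n : ℤ) • m') := by
          change QuotientAddGroup.mk' nM m =
            QuotientAddGroup.mk' nM (-((n : ℤ) • m' - m)) + QuotientAddGroup.mk' nM ((n : ℤ) • m')
          rw [← map_add]
          congr 1
          abel
        rw [e]
        refine add_mem ⟨_, rfl⟩ ?_
        have h0 : (QuotientAddGroup.mk ((n : ℤ) • m') : M ⧸ nM) = 0 := by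
          rw [QuotientAddGroup.eq_zero_iff, natCast_zsmul]
          exact ⟨m', rfl⟩
        rw [h0]
        exact zero_mem _
    · rintro _ ⟨t, rfl⟩
      rw [AddMonoidHom.mem_ker]
      change φ (t : M) = 0
      change ModN.mkQ n (QuotientAddGroup.mk' T (t : M)) = 0
      rw [hmkT, map_zero]
  -- `ker ψ = nT`
  set nT := (nsmulAddMonoidHom n : T →+ T).range with hnT
  have hkerψ : ψ.ker = nT := by
    apply le_antisymm
    · intro t ht
      rw [AddMonoidHom.mem_ker] at ht
      change QuotientAddGroup.mk' nM (t : M) = 0 at ht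
      rw [QuotientAddGroup.mk'_apply, QuotientAddGroup.eq_zero_iff] at ht
      obtain ⟨m, hm⟩ := ht
      rw [nsmulAddMonoidHom_apply] at hm
      have hmT : m ∈ T := by
        have ht' : IsOfFinAddOrder (t : M) := (AddCommGroup.mem_torsion _).mp t.2
        obtain ⟨k, hk, hkt⟩ := ht'.exists_nsmul_eq_zero
        refine (AddCommGroup.mem_torsion _).mpr
          (isOfFinAddOrder_iff_nsmul_eq_zero.mpr ⟨k * n, Nat.mul_pos hk (NeZero.pos n), ?_⟩)
        rw [mul_nsmul', hm, hkt]
      refine ⟨⟨m, hmT⟩, Subtype.ext ?_⟩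
      rw [nsmulAddMonoidHom_apply, AddSubgroup.coe_nsmul, hm]
    · rintro _ ⟨t, rfl⟩
      rw [AddMonoidHom.mem_ker]
      change QuotientAddGroup.mk' nM ((nsmulAddMonoidHom n t : T) : M) = 0
      rw [QuotientAddGroup.mk'_apply, QuotientAddGroup.eq_zero_iff]
      exact ⟨(t : M), by rw [nsmulAddMonoidHom_apply, nsmulAddMonoidHom_apply, AddSubgroup.coe_nsmul]⟩
  -- the kernel of `n` on `T` is `M[n]`
  have hkerT : Nat.card (nsmulAddMonoidHom n : T →+ T).ker =
      Nat.card (AddSubgroup.torsionBy M (n : ℤ)) := by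
    refine Nat.card_congr
      { toFun := fun x => ⟨(x.1 : M), ?_⟩
        invFun := fun y => ⟨⟨(y : M), ?_⟩, ?_⟩
        left_inv := fun x => by ext; rfl
        right_inv := fun y => by ext; rfl }
    · have hx := x.2
      rw [AddMonoidHom.mem_ker, nsmulAddMonoidHom_apply] at hx
      rw [AddSubgroup.torsionBy.nsmul_iff, ← AddSubgroup.coe_nsmul, hx, AddSubgroup.coe_zero]
    · exact (AddCommGroup.mem_torsion _).mpr (isOfFinAddOrder_iff_nsmul_eq_zero.mpr
        ⟨n, NeZero.pos n, AddSubgroup.torsionBy.nsmul_iff.mp y.2⟩)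
    · rw [AddMonoidHom.mem_ker, nsmulAddMonoidHom_apply]
      exact Subtype.ext (by
        rw [AddSubgroup.coe_nsmul, AddSubgroup.coe_zero]
        exact AddSubgroup.torsionBy.nsmul_iff.mp y.2)
  -- counting
  have h1 : Nat.card (M ⧸ nM) = Nat.card (ModN (M ⧸ T) n) * Nat.card φbar.ker := by
    rw [AddSubgroup.card_eq_card_quotient_mul_card_addSubgroup φbar.ker,
      Nat.card_congr (QuotientAddGroup.quotientKerEquivOfSurjective φbar hφbar_surj).toEquiv]
  have h2 : Nat.card ψ.range * Nat.card ψ.ker = Nat.card T := card_range_mul_card_ker ψ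
  have h3 : Nat.card nT * Nat.card (nsmulAddMonoidHom n : T →+ T).ker = Nat.card T :=
    card_range_mul_card_ker _
  haveI : Finite nT := inferInstance
  have hnT0 : Nat.card nT ≠ 0 := Nat.card_pos.ne'
  have h4 : Nat.card ψ.range = Nat.card (AddSubgroup.torsionBy M (n : ℤ)) := by
    rw [hkerψ] at h2
    rw [hkerT, mul_comm] at h3
    exact Nat.eq_of_mul_eq_mul_right (Nat.pos_of_ne_zero hnT0) (h2.trans h3.symm)
  rw [h1, ModN.natCard_eq, hrank, hkerφ, h4]

/-- **`n ^ rank E(K) · #E(K)[n] = #(E(K)/nE(K))`** for an elliptic curve over a number field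
(Mordell–Weil, tree theorem `WeierstrassCurve.module_finite_point_holds`, and
`natCard_quotient_nsmulRange_eq`). [folklore] -/
theorem natCard_quotient_nsmulRange_point_eq {K : Type*} [Field K] [NumberField K] (W : WeierstrassCurve K)
    [W.IsElliptic] (n : ℕ) [NeZero n] :
    Nat.card (W.toAffine.Point ⧸
        (nsmulAddMonoidHom n : W.toAffine.Point →+ W.toAffine.Point).range) =
      n ^ W.mordellWeilRank * Nat.card (AddSubgroup.torsionBy W.toAffine.Point (n : ℤ)) := by
  haveI : Module.Finite ℤ W.toAffine.Point := W.module_finite_point_holds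
  exact natCard_quotient_nsmulRange_eq W.toAffine.Point n

/-! ### Four rational `2`-torsion points -/

/-- With rational `2`-torsion `e₁, e₂, e₃` on an elliptic curve, `#E(F)[2] ≥ 4`: the points
`O, T₁, T₂, T₃` are distinct and killed by `2`. [folklore] -/
theorem four_le_natCard_torsionBy_two_of_splitTwoTorsion {F : Type*} [Field F] [CharZero F] [DecidableEq F]
    {W : Affine F} [W.IsElliptic] {e₁ e₂ e₃ : F} (h : W.SplitTwoTorsion e₁ e₂ e₃)
    [Finite (AddSubgroup.torsionBy W.Point ((2 : ℕ) : ℤ))] :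
    4 ≤ Nat.card (AddSubgroup.torsionBy W.Point ((2 : ℕ) : ℤ)) := by
  -- the three affine `2`-torsion points
  have hT : ∀ {a b c : F} (h' : W.SplitTwoTorsion a b c),
      (Point.some a (W.twoTorsionY a) (nonsingular_twoTorsion h') : W.Point) ∈
        AddSubgroup.torsionBy W.Point ((2 : ℕ) : ℤ) := fun h' => by
    rw [AddSubgroup.torsionBy.nsmul_iff, two_nsmul, ← eq_neg_iff_add_eq_zero, Point.neg_some]
    congr 1
    exact (negY_twoTorsionY _).symm
  let f : Fin 4 → AddSubgroup.torsionBy W.Point ((2 : ℕ) : ℤ) :=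
    ![⟨0, zero_mem _⟩, ⟨_, hT h⟩, ⟨_, hT h.swap₁₂⟩, ⟨_, hT h.swap₂₃.swap₁₂⟩]
  have hf : Function.Injective f := by
    intro i j hij
    have h12 := h.ne₁₂
    have h13 := h.ne₁₃
    have h23 := h.ne₂₃
    fin_cases i <;> fin_cases j <;>
      simp_all [f, Subtype.ext_iff, Point.some.injEq]
  have := Nat.card_le_card_of_injective f hf
  rwa [Nat.card_eq_fintype_card, Fintype.card_fin] at this


/-! ### Algebra: finiteness of `M[n]` -/

/-- `M[n]` is finite for a finitely generated abelian group `M` and `n ≥ 1` (it lies in the finite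
torsion subgroup). [folklore] -/
theorem finite_torsionBy_of_moduleFinite (M : Type*) [AddCommGroup M] [Module.Finite ℤ M] (n : ℕ) [NeZero n] :
    Finite (AddSubgroup.torsionBy M (n : ℤ)) := by
  haveI : IsNoetherian ℤ M := isNoetherian_of_isNoetherianRing_of_finite ℤ M
  haveI : Finite (AddCommGroup.torsion M) := by
    rw [← Submodule.torsion_int]
    exact Module.finite_of_fg_torsion (Submodule.torsion ℤ M) (Submodule.torsion_isTorsion)
  refine Finite.of_injective
    (fun x : AddSubgroup.torsionBy M (n : ℤ) => (⟨(x : M), ?_⟩ : AddCommGroup.torsion M)) ?_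
  · exact (AddCommGroup.mem_torsion _).mpr (isOfFinAddOrder_iff_nsmul_eq_zero.mpr
      ⟨n, NeZero.pos n, AddSubgroup.torsionBy.nsmul_iff.mp x.2⟩)
  · intro x y hxy
    exact Subtype.ext (by simpa using congrArg Subtype.val hxy)

end Literature.NumberTheory.EllipticCurves

end
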